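import Summits.BirchSwinnertonDyer.BirchSwinnertonDyer.Theorems.ManinLocalTwoThreeManinPrimeToThreeAtNineDiscLevelMinimal
import Summits.BirchSwinnertonDyer.BirchSwinnertonDyer.Theorems.ManinLocalTwoThreeTwistOrbitMinimalResidualSynthesis
import Summits.BirchSwinnertonDyer.BirchSwinnertonDyer.Theorems.ManinLocalTwoThreeManinPrimeToThreeAtNineKatoShiftLever
import HarnessLib

/-!
# Route `ManinLocalTwoThree` (cell `bsd-f2-manin`), crux C3 `ManinPrimeToThreeAtNine` (stmt-BirchSwinnertonDyer-22968): RESIDUAL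
# SYNTHESIS on the (odd level, 2-additivity, |Δ_min|, level, sign)-MINIMAL classes (C2 twin: `…DiscLevelMinimalResidualSynthesis`)

The residual syntheses of the registered lines `kato_shift_two` (C2) / `kato_shift_three` (C3) — crux ⟸ Euler-system
certificate on the `W[p]`-irreducible classes ∧ residual leaves — re-cut VERBATIM on the residues of this seat's
gen-3 reductions `maninLocalTwoThree_maninOddAtFour_of_discLevelMinimal` and
`maninLocalTwoThree_maninPrimeToThreeAtNine_of_discLevelMinimal` (clauses: no dyadic / odd semistable untwist; no
`χ₋₄`-untwist to a lattice-optimal additive curve of lower level with `|Δ_min| ≤`; no ALIGNED `χ±8`-untwist at ANY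
`2`-level with smaller `|Δ_min|`; no aligned same-level `χ_{q*}`-untwist with smaller `|Δ_min|`; twin normal form
`c₆ ≥ 0`). So every residual hypothesis of the lines (C2: Ra = `Δ > 0 ∧ 4 ∤ c ⟹ 2 ∤ c`, Rb = `W[2]` reducible; C3:
`W[3]` reducible) and the certificates themselves need only be supplied on these classes — census (this seat,
TWISTCENSUS2 join census7.py, `N ≤ 5·10⁵`): C2 220 053 of 897 670 (irr ∧ Δ<0 117 714 · Ra 47 992 · Rb 54 347; the
ACTIVE skeleton v4 carries Ra 55 478 / Rb 65 251); C3 89 125 of 657 019 (irreducible 81 600 · reducible 7 525).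
For the lead: `…_of_katoShift_of_discLevelMinimalResiduals` has the binder shape of the active
`…_of_orbitMinimalKatoShift_of_orbitMinimalResiduals` with the two residual stubs re-typed (seven ¬-clauses). HONEST
FRAMING: `proof.conditional` compositions; every certificate / residual input is open (Kato facts statement-only,
generation laws conjectural, residuals open). Manin's conjecture at `2`/`3` is NOT proved here; nothing about BSD is
proved here. Seat bsd-line-manin23-p2 (gen 3).
-/

set_option autoImplicit false
set_option linter.dupNamespace false

noncomputable section

open scoped Classical MatrixGroups ModularForm

namespace Summit.BirchSwinnertonDyer.BirchSwinnertonDyer.Theorems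

open CongruenceSubgroup WeierstrassCurve Literature.NumberTheory.EllipticCurves
  Literature.NumberTheory.EllipticCurves.ModularForms
  Summit.BirchSwinnertonDyer.Rank1Residual.ManinAdditive

/-! ## C3 -/

/-- **C3 ⟸ (shift-twist certificate on the disc-level-minimal `W[3]`-irreducible classes) ∧ (Manin at `3` on the
disc-level-minimal `W[3]`-reducible classes)** — both hypotheses carry the seven ¬-clauses of
`maninLocalTwoThree_maninPrimeToThreeAtNine_of_discLevelMinimal`; excluded middle on irreducibility. Census: the
reducible hypothesis concerns 7 525 optimal classes with `9 ∣ N ≤ 5·10⁵`, the irreducible one 81 600.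
[cite: Stevens1989, Lemmas (5.2), (5.4)] [cite: Kato2004Asterisque, Thm. 9.7 (p. 189)] -/
theorem maninLocalTwoThree_maninPrimeToThreeAtNine_of_discLevelMinimalKatoShift_of_discLevelMinimalReducible
    (hA : ∀ (W : WeierstrassCurve ℚ) [W.IsElliptic] [W.IsGloballyMinimal] {N : ℕ} [NeZero N]
      (D : ModularParametrizationData W N),
      (∀ z ∈ D.L.lattice, ∃ w ∈ periodLattice D.f, z = D.c * w) → 3 ^ 2 ∣ N →
      ¬ (∃ (W' : WeierstrassCurve ℚ) (d : ℤ), W'.IsElliptic ∧ W'.IsGloballyMinimal ∧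
        (d = -3) ∧ IsIsogenous W (W'.quadraticTwist (d : ℚ)) ∧
        ¬ 3 ^ 2 ∣ W'.conductorNorm ℤ) →
      ¬ (∃ (W' : WeierstrassCurve ℚ) (q : ℕ), W'.IsElliptic ∧ W'.IsGloballyMinimal ∧
        q.Prime ∧ q ≠ 2 ∧ q ≠ 3 ∧ q ^ 2 ∣ N ∧
        IsIsogenous W (W'.quadraticTwist (((-1 : ℤ) ^ (q / 2) * q : ℤ) : ℚ)) ∧
        ¬ q ^ 2 ∣ W'.conductorNorm ℤ) →
      ¬ (∃ (W' : WeierstrassCurve ℚ) (d : ℤ), W'.IsElliptic ∧ W'.IsGloballyMinimal ∧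
        (d = -1 ∨ d = 2 ∨ d = -2) ∧ 2 ^ 2 ∣ N ∧ IsIsogenous W (W'.quadraticTwist (d : ℚ)) ∧
        ¬ 2 ^ 2 ∣ W'.conductorNorm ℤ) →
      ¬ (∃ (A : WeierstrassCurve ℚ) (_ : A.IsElliptic) (_ : A.IsGloballyMinimal) (N' : ℕ) (_ : NeZero N')
        (D' : ModularParametrizationData A N'),
        (∀ z ∈ D'.L.lattice, ∃ w ∈ periodLattice D'.f, z = D'.c * w) ∧ 2 ^ 4 ∣ N ∧
        2 ^ 2 ∣ A.conductorNorm ℤ ∧ A.conductorNorm ℤ ∣ N ∧ A.conductorNorm ℤ < N ∧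
        IsIsogenous W (A.quadraticTwist ((-1 : ℤ) : ℚ)) ∧
        A.minimalDiscriminantInt.natAbs ≤ W.minimalDiscriminantInt.natAbs) →
      ¬ (∃ (A : WeierstrassCurve ℚ) (_ : A.IsElliptic) (_ : A.IsGloballyMinimal) (N' : ℕ) (_ : NeZero N')
        (D' : ModularParametrizationData A N') (d : ℤ) (C : WeierstrassCurve ℚ) (u : VariableChange ℚ),
        C.IsElliptic ∧ C.IsGloballyMinimal ∧
        (∀ z ∈ D'.L.lattice, ∃ w ∈ periodLattice D'.f, z = D'.c * w) ∧ (d = 2 ∨ d = -2) ∧ 2 ^ 2 ∣ N ∧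
        2 ^ 2 ∣ A.conductorNorm ℤ ∧ A.conductorNorm ℤ ∣ 2 ^ 6 * N ∧
        IsIsogenous W (A.quadraticTwist (d : ℚ)) ∧ u • A.quadraticTwist (d : ℚ) = C ∧
        C.Δ = (d : ℚ) ^ 6 * A.Δ ∧
        (A.minimalDiscriminantInt.natAbs < W.minimalDiscriminantInt.natAbs ∨
          (A.conductorNorm ℤ < N ∧ A.minimalDiscriminantInt.natAbs ≤ W.minimalDiscriminantInt.natAbs))) →
      ¬ (∃ (A : WeierstrassCurve ℚ) (_ : A.IsElliptic) (_ : A.IsGloballyMinimal)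
        (D' : ModularParametrizationData A N) (q : ℕ) (C : WeierstrassCurve ℚ) (u : VariableChange ℚ),
        C.IsElliptic ∧ C.IsGloballyMinimal ∧
        (∀ z ∈ D'.L.lattice, ∃ w ∈ periodLattice D'.f, z = D'.c * w) ∧ q.Prime ∧ q ≠ 2 ∧ q ^ 2 ∣ N ∧
        IsIsogenous C W ∧ u • A.quadraticTwist (((-1 : ℤ) ^ (q / 2) * q : ℤ) : ℚ) = C ∧
        C.Δ = ((((-1 : ℤ) ^ (q / 2) * q : ℤ)) : ℚ) ^ 6 * A.Δ ∧
        A.minimalDiscriminantInt.natAbs < W.minimalDiscriminantInt.natAbs) →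
      ¬ (W.c₆ < 0 ∧ ∃ (A : WeierstrassCurve ℚ) (_ : A.IsElliptic) (_ : A.IsGloballyMinimal)
        (D' : ModularParametrizationData A N),
        (∀ z ∈ D'.L.lattice, ∃ w ∈ periodLattice D'.f, z = D'.c * w) ∧ 2 ^ 4 ∣ N ∧
        2 ^ 2 ∣ A.conductorNorm ℤ ∧ IsIsogenous W (A.quadraticTwist ((-1 : ℤ) : ℚ)) ∧
        A.minimalDiscriminantInt.natAbs ≤ W.minimalDiscriminantInt.natAbs ∧ 0 < A.c₆) →
      W.HasIrreducibleModPGaloisRep 3 → ¬ (3 : ℤ) ∣ D.c)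
    (hB : ∀ (W : WeierstrassCurve ℚ) [W.IsElliptic] [W.IsGloballyMinimal] {N : ℕ} [NeZero N]
      (D : ModularParametrizationData W N),
      (∀ z ∈ D.L.lattice, ∃ w ∈ periodLattice D.f, z = D.c * w) → 3 ^ 2 ∣ N →
      ¬ (∃ (W' : WeierstrassCurve ℚ) (d : ℤ), W'.IsElliptic ∧ W'.IsGloballyMinimal ∧
        (d = -3) ∧ IsIsogenous W (W'.quadraticTwist (d : ℚ)) ∧
        ¬ 3 ^ 2 ∣ W'.conductorNorm ℤ) →
      ¬ (∃ (W' : WeierstrassCurve ℚ) (q : ℕ), W'.IsElliptic ∧ W'.IsGloballyMinimal ∧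
        q.Prime ∧ q ≠ 2 ∧ q ≠ 3 ∧ q ^ 2 ∣ N ∧
        IsIsogenous W (W'.quadraticTwist (((-1 : ℤ) ^ (q / 2) * q : ℤ) : ℚ)) ∧
        ¬ q ^ 2 ∣ W'.conductorNorm ℤ) →
      ¬ (∃ (W' : WeierstrassCurve ℚ) (d : ℤ), W'.IsElliptic ∧ W'.IsGloballyMinimal ∧
        (d = -1 ∨ d = 2 ∨ d = -2) ∧ 2 ^ 2 ∣ N ∧ IsIsogenous W (W'.quadraticTwist (d : ℚ)) ∧
        ¬ 2 ^ 2 ∣ W'.conductorNorm ℤ) →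
      ¬ (∃ (A : WeierstrassCurve ℚ) (_ : A.IsElliptic) (_ : A.IsGloballyMinimal) (N' : ℕ) (_ : NeZero N')
        (D' : ModularParametrizationData A N'),
        (∀ z ∈ D'.L.lattice, ∃ w ∈ periodLattice D'.f, z = D'.c * w) ∧ 2 ^ 4 ∣ N ∧
        2 ^ 2 ∣ A.conductorNorm ℤ ∧ A.conductorNorm ℤ ∣ N ∧ A.conductorNorm ℤ < N ∧
        IsIsogenous W (A.quadraticTwist ((-1 : ℤ) : ℚ)) ∧
        A.minimalDiscriminantInt.natAbs ≤ W.minimalDiscriminantInt.natAbs) →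
      ¬ (∃ (A : WeierstrassCurve ℚ) (_ : A.IsElliptic) (_ : A.IsGloballyMinimal) (N' : ℕ) (_ : NeZero N')
        (D' : ModularParametrizationData A N') (d : ℤ) (C : WeierstrassCurve ℚ) (u : VariableChange ℚ),
        C.IsElliptic ∧ C.IsGloballyMinimal ∧
        (∀ z ∈ D'.L.lattice, ∃ w ∈ periodLattice D'.f, z = D'.c * w) ∧ (d = 2 ∨ d = -2) ∧ 2 ^ 2 ∣ N ∧
        2 ^ 2 ∣ A.conductorNorm ℤ ∧ A.conductorNorm ℤ ∣ 2 ^ 6 * N ∧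
        IsIsogenous W (A.quadraticTwist (d : ℚ)) ∧ u • A.quadraticTwist (d : ℚ) = C ∧
        C.Δ = (d : ℚ) ^ 6 * A.Δ ∧
        (A.minimalDiscriminantInt.natAbs < W.minimalDiscriminantInt.natAbs ∨
          (A.conductorNorm ℤ < N ∧ A.minimalDiscriminantInt.natAbs ≤ W.minimalDiscriminantInt.natAbs))) →
      ¬ (∃ (A : WeierstrassCurve ℚ) (_ : A.IsElliptic) (_ : A.IsGloballyMinimal)
        (D' : ModularParametrizationData A N) (q : ℕ) (C : WeierstrassCurve ℚ) (u : VariableChange ℚ),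
        C.IsElliptic ∧ C.IsGloballyMinimal ∧
        (∀ z ∈ D'.L.lattice, ∃ w ∈ periodLattice D'.f, z = D'.c * w) ∧ q.Prime ∧ q ≠ 2 ∧ q ^ 2 ∣ N ∧
        IsIsogenous C W ∧ u • A.quadraticTwist (((-1 : ℤ) ^ (q / 2) * q : ℤ) : ℚ) = C ∧
        C.Δ = ((((-1 : ℤ) ^ (q / 2) * q : ℤ)) : ℚ) ^ 6 * A.Δ ∧
        A.minimalDiscriminantInt.natAbs < W.minimalDiscriminantInt.natAbs) →
      ¬ (W.c₆ < 0 ∧ ∃ (A : WeierstrassCurve ℚ) (_ : A.IsElliptic) (_ : A.IsGloballyMinimal)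
        (D' : ModularParametrizationData A N),
        (∀ z ∈ D'.L.lattice, ∃ w ∈ periodLattice D'.f, z = D'.c * w) ∧ 2 ^ 4 ∣ N ∧
        2 ^ 2 ∣ A.conductorNorm ℤ ∧ IsIsogenous W (A.quadraticTwist ((-1 : ℤ) : ℚ)) ∧
        A.minimalDiscriminantInt.natAbs ≤ W.minimalDiscriminantInt.natAbs ∧ 0 < A.c₆) →
      ¬ W.HasIrreducibleModPGaloisRep 3 → ¬ (3 : ℤ) ∣ D.c)
 :
    Summit.BirchSwinnertonDyer.BirchSwinnertonDyer.Theses.ManinLocalTwoThree.ManinPrimeToThreeAtNine :=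
  maninLocalTwoThree_maninPrimeToThreeAtNine_of_discLevelMinimal
    (fun _hM _hAU _hC _hnf W _ _ N _ D hopt h9 h1 h2 h3 h4 h5 h6 h7 => by
      show ¬ (3 : ℤ) ∣ D.c
      by_cases hirr : W.HasIrreducibleModPGaloisRep 3
      · exact hA W D hopt h9 h1 h2 h3 h4 h5 h6 h7 hirr
      · exact hB W D hopt h9 h1 h2 h3 h4 h5 h6 h7 hirr)

/-- **C3 ⟸ E-es-18 `KatoShiftTwistManinThree` ∧ (Manin at `3` on the disc-level-minimal `W[3]`-reducible classes)**.
[cite: Stevens1989, Lemmas (5.2), (5.4)] [cite: Kato2004Asterisque, Thm. 9.7 (p. 189)] -/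
theorem maninLocalTwoThree_maninPrimeToThreeAtNine_of_katoShift_of_discLevelMinimalReducible
    (hA : KatoShiftTwistManinThree)
    (hB : ∀ (W : WeierstrassCurve ℚ) [W.IsElliptic] [W.IsGloballyMinimal] {N : ℕ} [NeZero N]
      (D : ModularParametrizationData W N),
      (∀ z ∈ D.L.lattice, ∃ w ∈ periodLattice D.f, z = D.c * w) → 3 ^ 2 ∣ N →
      ¬ (∃ (W' : WeierstrassCurve ℚ) (d : ℤ), W'.IsElliptic ∧ W'.IsGloballyMinimal ∧
        (d = -3) ∧ IsIsogenous W (W'.quadraticTwist (d : ℚ)) ∧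
        ¬ 3 ^ 2 ∣ W'.conductorNorm ℤ) →
      ¬ (∃ (W' : WeierstrassCurve ℚ) (q : ℕ), W'.IsElliptic ∧ W'.IsGloballyMinimal ∧
        q.Prime ∧ q ≠ 2 ∧ q ≠ 3 ∧ q ^ 2 ∣ N ∧
        IsIsogenous W (W'.quadraticTwist (((-1 : ℤ) ^ (q / 2) * q : ℤ) : ℚ)) ∧
        ¬ q ^ 2 ∣ W'.conductorNorm ℤ) →
      ¬ (∃ (W' : WeierstrassCurve ℚ) (d : ℤ), W'.IsElliptic ∧ W'.IsGloballyMinimal ∧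
        (d = -1 ∨ d = 2 ∨ d = -2) ∧ 2 ^ 2 ∣ N ∧ IsIsogenous W (W'.quadraticTwist (d : ℚ)) ∧
        ¬ 2 ^ 2 ∣ W'.conductorNorm ℤ) →
      ¬ (∃ (A : WeierstrassCurve ℚ) (_ : A.IsElliptic) (_ : A.IsGloballyMinimal) (N' : ℕ) (_ : NeZero N')
        (D' : ModularParametrizationData A N'),
        (∀ z ∈ D'.L.lattice, ∃ w ∈ periodLattice D'.f, z = D'.c * w) ∧ 2 ^ 4 ∣ N ∧
        2 ^ 2 ∣ A.conductorNorm ℤ ∧ A.conductorNorm ℤ ∣ N ∧ A.conductorNorm ℤ < N ∧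
        IsIsogenous W (A.quadraticTwist ((-1 : ℤ) : ℚ)) ∧
        A.minimalDiscriminantInt.natAbs ≤ W.minimalDiscriminantInt.natAbs) →
      ¬ (∃ (A : WeierstrassCurve ℚ) (_ : A.IsElliptic) (_ : A.IsGloballyMinimal) (N' : ℕ) (_ : NeZero N')
        (D' : ModularParametrizationData A N') (d : ℤ) (C : WeierstrassCurve ℚ) (u : VariableChange ℚ),
        C.IsElliptic ∧ C.IsGloballyMinimal ∧
        (∀ z ∈ D'.L.lattice, ∃ w ∈ periodLattice D'.f, z = D'.c * w) ∧ (d = 2 ∨ d = -2) ∧ 2 ^ 2 ∣ N ∧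
        2 ^ 2 ∣ A.conductorNorm ℤ ∧ A.conductorNorm ℤ ∣ 2 ^ 6 * N ∧
        IsIsogenous W (A.quadraticTwist (d : ℚ)) ∧ u • A.quadraticTwist (d : ℚ) = C ∧
        C.Δ = (d : ℚ) ^ 6 * A.Δ ∧
        (A.minimalDiscriminantInt.natAbs < W.minimalDiscriminantInt.natAbs ∨
          (A.conductorNorm ℤ < N ∧ A.minimalDiscriminantInt.natAbs ≤ W.minimalDiscriminantInt.natAbs))) →
      ¬ (∃ (A : WeierstrassCurve ℚ) (_ : A.IsElliptic) (_ : A.IsGloballyMinimal)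
        (D' : ModularParametrizationData A N) (q : ℕ) (C : WeierstrassCurve ℚ) (u : VariableChange ℚ),
        C.IsElliptic ∧ C.IsGloballyMinimal ∧
        (∀ z ∈ D'.L.lattice, ∃ w ∈ periodLattice D'.f, z = D'.c * w) ∧ q.Prime ∧ q ≠ 2 ∧ q ^ 2 ∣ N ∧
        IsIsogenous C W ∧ u • A.quadraticTwist (((-1 : ℤ) ^ (q / 2) * q : ℤ) : ℚ) = C ∧
        C.Δ = ((((-1 : ℤ) ^ (q / 2) * q : ℤ)) : ℚ) ^ 6 * A.Δ ∧
        A.minimalDiscriminantInt.natAbs < W.minimalDiscriminantInt.natAbs) →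
      ¬ (W.c₆ < 0 ∧ ∃ (A : WeierstrassCurve ℚ) (_ : A.IsElliptic) (_ : A.IsGloballyMinimal)
        (D' : ModularParametrizationData A N),
        (∀ z ∈ D'.L.lattice, ∃ w ∈ periodLattice D'.f, z = D'.c * w) ∧ 2 ^ 4 ∣ N ∧
        2 ^ 2 ∣ A.conductorNorm ℤ ∧ IsIsogenous W (A.quadraticTwist ((-1 : ℤ) : ℚ)) ∧
        A.minimalDiscriminantInt.natAbs ≤ W.minimalDiscriminantInt.natAbs ∧ 0 < A.c₆) →
      ¬ W.HasIrreducibleModPGaloisRep 3 → ¬ (3 : ℤ) ∣ D.c)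
 :
    Summit.BirchSwinnertonDyer.BirchSwinnertonDyer.Theses.ManinLocalTwoThree.ManinPrimeToThreeAtNine :=
  maninLocalTwoThree_maninPrimeToThreeAtNine_of_discLevelMinimalKatoShift_of_discLevelMinimalReducible
    (fun W _ _ _ _ D hopt h9 _ _ _ _ _ _ _ hirr => hA W D hopt h9 hirr) hB

/-- **C3 ⟸ the `p = 3` Kato fact F-es-18 ∧ the shift-generation law E-es-19 ∧ (Manin at `3` on the
disc-level-minimal `W[3]`-reducible classes)** — the line `kato_shift_three` end to end with the reducible residual on
7 525 optimal classes (`9 ∣ N ≤ 5·10⁵`). A `proof.conditional`.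
[cite: Kato2004Asterisque, Thm. 9.7 (p. 189)] [cite: Stevens1989, Lemmas (5.2), (5.4)] -/
theorem maninLocalTwoThree_maninPrimeToThreeAtNine_of_katoFact_of_generation_of_discLevelMinimalReducible
    (hK : kato_neron_isIntegral_twistedSymbolSum_of_additive_three_polar) (hG : ShiftClassGenerationThree)
    (hB : ∀ (W : WeierstrassCurve ℚ) [W.IsElliptic] [W.IsGloballyMinimal] {N : ℕ} [NeZero N]
      (D : ModularParametrizationData W N),
      (∀ z ∈ D.L.lattice, ∃ w ∈ periodLattice D.f, z = D.c * w) → 3 ^ 2 ∣ N →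
      ¬ (∃ (W' : WeierstrassCurve ℚ) (d : ℤ), W'.IsElliptic ∧ W'.IsGloballyMinimal ∧
        (d = -3) ∧ IsIsogenous W (W'.quadraticTwist (d : ℚ)) ∧
        ¬ 3 ^ 2 ∣ W'.conductorNorm ℤ) →
      ¬ (∃ (W' : WeierstrassCurve ℚ) (q : ℕ), W'.IsElliptic ∧ W'.IsGloballyMinimal ∧
        q.Prime ∧ q ≠ 2 ∧ q ≠ 3 ∧ q ^ 2 ∣ N ∧
        IsIsogenous W (W'.quadraticTwist (((-1 : ℤ) ^ (q / 2) * q : ℤ) : ℚ)) ∧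
        ¬ q ^ 2 ∣ W'.conductorNorm ℤ) →
      ¬ (∃ (W' : WeierstrassCurve ℚ) (d : ℤ), W'.IsElliptic ∧ W'.IsGloballyMinimal ∧
        (d = -1 ∨ d = 2 ∨ d = -2) ∧ 2 ^ 2 ∣ N ∧ IsIsogenous W (W'.quadraticTwist (d : ℚ)) ∧
        ¬ 2 ^ 2 ∣ W'.conductorNorm ℤ) →
      ¬ (∃ (A : WeierstrassCurve ℚ) (_ : A.IsElliptic) (_ : A.IsGloballyMinimal) (N' : ℕ) (_ : NeZero N')
        (D' : ModularParametrizationData A N'),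
        (∀ z ∈ D'.L.lattice, ∃ w ∈ periodLattice D'.f, z = D'.c * w) ∧ 2 ^ 4 ∣ N ∧
        2 ^ 2 ∣ A.conductorNorm ℤ ∧ A.conductorNorm ℤ ∣ N ∧ A.conductorNorm ℤ < N ∧
        IsIsogenous W (A.quadraticTwist ((-1 : ℤ) : ℚ)) ∧
        A.minimalDiscriminantInt.natAbs ≤ W.minimalDiscriminantInt.natAbs) →
      ¬ (∃ (A : WeierstrassCurve ℚ) (_ : A.IsElliptic) (_ : A.IsGloballyMinimal) (N' : ℕ) (_ : NeZero N')
        (D' : ModularParametrizationData A N') (d : ℤ) (C : WeierstrassCurve ℚ) (u : VariableChange ℚ),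
        C.IsElliptic ∧ C.IsGloballyMinimal ∧
        (∀ z ∈ D'.L.lattice, ∃ w ∈ periodLattice D'.f, z = D'.c * w) ∧ (d = 2 ∨ d = -2) ∧ 2 ^ 2 ∣ N ∧
        2 ^ 2 ∣ A.conductorNorm ℤ ∧ A.conductorNorm ℤ ∣ 2 ^ 6 * N ∧
        IsIsogenous W (A.quadraticTwist (d : ℚ)) ∧ u • A.quadraticTwist (d : ℚ) = C ∧
        C.Δ = (d : ℚ) ^ 6 * A.Δ ∧
        (A.minimalDiscriminantInt.natAbs < W.minimalDiscriminantInt.natAbs ∨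
          (A.conductorNorm ℤ < N ∧ A.minimalDiscriminantInt.natAbs ≤ W.minimalDiscriminantInt.natAbs))) →
      ¬ (∃ (A : WeierstrassCurve ℚ) (_ : A.IsElliptic) (_ : A.IsGloballyMinimal)
        (D' : ModularParametrizationData A N) (q : ℕ) (C : WeierstrassCurve ℚ) (u : VariableChange ℚ),
        C.IsElliptic ∧ C.IsGloballyMinimal ∧
        (∀ z ∈ D'.L.lattice, ∃ w ∈ periodLattice D'.f, z = D'.c * w) ∧ q.Prime ∧ q ≠ 2 ∧ q ^ 2 ∣ N ∧
        IsIsogenous C W ∧ u • A.quadraticTwist (((-1 : ℤ) ^ (q / 2) * q : ℤ) : ℚ) = C ∧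
        C.Δ = ((((-1 : ℤ) ^ (q / 2) * q : ℤ)) : ℚ) ^ 6 * A.Δ ∧
        A.minimalDiscriminantInt.natAbs < W.minimalDiscriminantInt.natAbs) →
      ¬ (W.c₆ < 0 ∧ ∃ (A : WeierstrassCurve ℚ) (_ : A.IsElliptic) (_ : A.IsGloballyMinimal)
        (D' : ModularParametrizationData A N),
        (∀ z ∈ D'.L.lattice, ∃ w ∈ periodLattice D'.f, z = D'.c * w) ∧ 2 ^ 4 ∣ N ∧
        2 ^ 2 ∣ A.conductorNorm ℤ ∧ IsIsogenous W (A.quadraticTwist ((-1 : ℤ) : ℚ)) ∧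
        A.minimalDiscriminantInt.natAbs ≤ W.minimalDiscriminantInt.natAbs ∧ 0 < A.c₆) →
      ¬ W.HasIrreducibleModPGaloisRep 3 → ¬ (3 : ℤ) ∣ D.c)
 :
    Summit.BirchSwinnertonDyer.BirchSwinnertonDyer.Theses.ManinLocalTwoThree.ManinPrimeToThreeAtNine :=
  maninLocalTwoThree_maninPrimeToThreeAtNine_of_katoShift_of_discLevelMinimalReducible
    (ManinLocalTwoThree.katoShiftTwistManinThree_of_katoFact_of_generation hK hG) hB

end Summit.BirchSwinnertonDyer.BirchSwinnertonDyer.Theorems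

end
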